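import Summits.QuantumFields.YangMills.Theorems.IR.Negative.FixedMesh.LayerTwist

/-!
# Fixed-mesh negative for format T, part 2/6: clause (i_T) of `TypShellCond` isolated; the charged column bound at the twist row

Part of the fixed-mesh negative for format T of crux `IR` (stmt-QuantumFields-19354, registered cut `af-pincer-T`
sha16 0308f95ca6f6a115); headline module `Theorems/IR/Negative/TypShellCondFalseFixedMesh.lean` (statement, provenance,
reading).  Content re-homed verbatim from the crux workfile `Cruxes/IR/CruxIdea8FixedMesh.lean` (cruxidea-8 GEN 5,
tree sha16 d880b42bb52976de) under the namespace `Summit.QuantumFields.YangMills.Cruxes.IR.FixedMesh`; sorry-free.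
-/

set_option autoImplicit false

noncomputable section

open MeasureTheory Filter Topology
open Literature.MathematicalPhysics.QuantumLattice
open Literature.Probability.LatticeModels
open Summit.QuantumFields.YangMills.Cruxes.IR.Tempered (cellEdges windowCells regionEdges)
open Summit.QuantumFields.YangMills.Cruxes.IR.ShellTempered (windowCellsPlus)
open Summit.QuantumFields.YangMills.Cruxes.IR.OnsetFormats (TypShellCond shellCount OnsetMixingTypical)

namespace Summit.QuantumFields.YangMills.Cruxes.IR.FixedMesh

/-! ## §2 The hedge format, verbatim, and its clause (i_T) isolated -/


section Format

open Literature.MathematicalPhysics.QuantumFieldTheory (wilsonMeasure GaugeConfig)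

variable {G : Type} [Group G] [TopologicalSpace G] [IsTopologicalGroup G] [CompactSpace G]
  [MeasurableSpace G] [BorelSpace G]


/-- **Clause (i_T) isolated** at a frame `w` and a typical class `Typ` (verbatim third conjunct of `TypShellCond`). -/
def ClauseI {N : ℕ} (ρ : G →* Matrix (Fin N) (Fin N) ℂ) (β : ℝ) (w : Fin 4 → ℤ → ℤ) (n : ℕ) (ε : ℝ)
    (Typ : (Fin 4 → ℤ) → Set (LGConfig 4 G)) : Prop :=
  ∀ Y : Finset (Fin 4 → ℤ), Y ⊆ windowCells n → (0 : Fin 4 → ℤ) ∈ Y →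
    ∀ σ σ' : LGConfig 4 G,
      (∀ c ∈ windowCellsPlus n, c ∉ Y → σ ∈ Typ c ∧ σ' ∈ Typ c) →
      (∀ c ∈ windowCellsPlus n, c ∉ Y → c ∈ windowCells n → ∀ e ∈ cellEdges w c, σ e = σ' e) →
      ∀ f : LGConfig 4 G → ℝ, IsCylinder f (cellEdges w 0) → Measurable f → (∀ U, 0 ≤ f U ∧ f U ≤ 1) →
        |(∫ U, f U ∂(ymSpecification ρ β (regionEdges w Y) σ)) -
          ∫ U, f U ∂(ymSpecification ρ β (regionEdges w Y) σ')| ≤ ε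

/-- **PROVED (definitional).** The format hands out, at the standard frame, a measurable cell-local class satisfying
(i_T) (and (ii_T), (iii_T), dropped here except the single-cell torus anchor used in §4). -/
theorem clauseI_of_typShellCond {N : ℕ} {ρ : G →* Matrix (Fin N) (Fin N) ℂ} {β : ℝ} {b n : ℕ} {ε δ : ℝ}
    (h : TypShellCond ρ β b n ε δ) :
    ∃ Typ : (Fin 4 → ℤ) → Set (LGConfig 4 G),
      (∀ c, MeasurableSet (Typ c)) ∧
      (∀ c, DependsOn (fun σ : LGConfig 4 G => σ ∈ Typ c) ↑(cellEdges (stdFrame b) c)) ∧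
      ClauseI ρ β (stdFrame b) n ε Typ ∧
      (∀ S : ℕ, 4 * b ≤ 2 * S + 1 → ∀ c : Fin 4 → ℤ,
        (∀ i, -(S : ℤ) ≤ stdFrame b i (c i) ∧ stdFrame b i (c i + 1) ≤ (S : ℤ) + 1) →
          (wilsonMeasure (d := 4) (L := 2 * S + 1) ρ β)
              {V : GaugeConfig 4 (2 * S + 1) G | torusLift (2 * S + 1) V ∉ Typ c} ≤ ENNReal.ofReal δ) := by
  obtain ⟨Typ, hmeas, hdep, hI, -, hIII⟩ := h (stdFrame b) (stdFrame_admissible b)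
  refine ⟨Typ, hmeas, hdep, hI, fun S hS c hc => ?_⟩
  have h1 := hIII S hS {c} (Finset.singleton_nonempty c) (fun c' hc' => by
    rw [Finset.mem_singleton] at hc'; subst hc'; exact hc)
  simpa using h1

end Format

/-! ## §3 Clause (i_T) at the slab region forces charged cell observables to be small (M) -/

section ColumnBound

variable {G : Type} [Group G] [TopologicalSpace G] [IsTopologicalGroup G] [CompactSpace G]
  [SecondCountableTopology G] [MeasurableSpace G] [BorelSpace G]
  {N : ℕ} (ρ : G →* Matrix (Fin N) (Fin N) ℂ)

/-- **(M) The twist row of the HEDGE format.**  If `Typ` satisfies (i_T) at the standard frame, then for `Y = rowCells n`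
(admissible: `rowCells_subset`, `zero_mem_rowCells`), every datum `ζ` such that `ζ` AND `τ_k ζ` are typical on the
cells of window+shell off the row, and every cell-0 cylinder `g`, `‖g‖ ≤ 1`, of charge `c ≠ 1` under `τ_k`
(`1 ≤ k ≤ b`):  `‖∫ g dγ_row(ζ)‖ ≤ 4ε/‖1 − c‖`.
Proof: the pair `(ζ, τ_k ζ)` agrees on the window cells off the row (`layerTwist_agree_off_row`), so (i_T) applies
to the four `[0,1]`-valued parts `(Re g)^±/‖·‖, (Im g)^±` (cylinder, measurable); §1 gives
`∫ g dγ(τ_k ζ) = c ∫ g dγ(ζ)`, hence `‖1−c‖·‖∫ g dγ(ζ)‖ ≤ 4ε`.  For GAUGE-INVARIANT `Typ` the typicality of `τ_k ζ` is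
that of `ζ` (`mem_layerTwist_iff`) — no data predicate that is a property of the gauge orbit removes this row. -/
theorem norm_integral_charged_le_of_clauseI (hρ : Continuous ρ) {β : ℝ} {b n : ℕ} {ε : ℝ}
    {Typ : (Fin 4 → ℤ) → Set (LGConfig 4 G)}
    (hI : ClauseI ρ β (stdFrame b) n ε Typ)
    {g₀ : G} (hg : g₀ ∈ Subgroup.center G) {k : ℤ} (hk : 1 ≤ k ∧ k ≤ (b : ℤ)) {c : ℂ} (hc : c ≠ 1)
    {g : LGConfig 4 G → ℂ} (hgm : Measurable g) (hgb : ∀ U, ‖g U‖ ≤ 1)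
    (hgcyl : IsCylinder g (cellEdges (stdFrame b) 0))
    (hcharged : ∀ U, g (layerTwist k g₀ U) = c * g U) (ζ : LGConfig 4 G)
    (hζ : ∀ c' ∈ windowCellsPlus n, c' ∉ rowCells n → ζ ∈ Typ c' ∧ layerTwist k g₀ ζ ∈ Typ c') :
    ‖∫ U, g U ∂(ymSpecification ρ β (rowRegion b n) ζ)‖ ≤ 4 * ε / ‖1 - c‖ := by
  classical
  set μ := ymSpecification ρ β (rowRegion b n) ζ with hμ
  set μ' := ymSpecification ρ β (rowRegion b n) (layerTwist k g₀ ζ) with hμ'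
  haveI : IsProbabilityMeasure μ := isProbabilityMeasure_ymSpecification ρ hρ β _ ζ
  haveI : IsProbabilityMeasure μ' := isProbabilityMeasure_ymSpecification ρ hρ β _ _
  -- clause (i_T) applied to the admissible, typical twist pair `(ζ, τ_k ζ)` at `Y = rowCells n`
  have hpair : ∀ f : LGConfig 4 G → ℝ, IsCylinder f (cellEdges (stdFrame b) 0) → Measurable f →
      (∀ U, 0 ≤ f U ∧ f U ≤ 1) → |(∫ U, f U ∂μ) - ∫ U, f U ∂μ'| ≤ ε := fun f hf hfm hf01 =>
    hI (rowCells n) (rowCells_subset n) (zero_mem_rowCells n) ζ (layerTwist k g₀ ζ) hζ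
      (layerTwist_agree_off_row hk g₀ ζ) f hf hfm hf01
  -- real tests `u` with `|u| ≤ 1`: shift to `(1 + u)/2 ∈ [0, 1]`
  have key : ∀ u : LGConfig 4 G → ℝ, IsCylinder u (cellEdges (stdFrame b) 0) → Measurable u →
      (∀ U, |u U| ≤ 1) → |(∫ U, u U ∂μ) - ∫ U, u U ∂μ'| ≤ 2 * ε := by
    intro u hu hum hub
    have hcyl : IsCylinder (fun U => (1 + u U) / 2) (cellEdges (stdFrame b) 0) := by
      intro x y hxy
      show (1 + u x) / 2 = (1 + u y) / 2
      rw [hu hxy]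
    have h01 : ∀ U, 0 ≤ (1 + u U) / 2 ∧ (1 + u U) / 2 ≤ 1 := fun U => by
      have := abs_le.1 (hub U)
      constructor <;> linarith [this.1, this.2]
    have h := hpair _ hcyl ((measurable_const.add hum).div_const 2) h01
    have hi : ∀ ν : Measure (LGConfig 4 G), IsProbabilityMeasure ν → Integrable u ν := fun ν _ =>
      (integrable_const (1 : ℝ)).mono' hum.aestronglyMeasurable
        (ae_of_all _ fun U => by simpa [Real.norm_eq_abs] using hub U)
    have hshift : ∀ ν : Measure (LGConfig 4 G), IsProbabilityMeasure ν →
        ∫ U, (1 + u U) / 2 ∂ν = (1 + ∫ U, u U ∂ν) / 2 := by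
      intro ν hν
      have h1 : ∫ U, (1 + u U) ∂ν = 1 + ∫ U, u U ∂ν := by
        rw [integral_add (integrable_const _) (hi ν hν)]
        simp
      simp_rw [div_eq_mul_inv]
      rw [integral_mul_const, h1]
    rw [hshift μ inferInstance, hshift μ' inferInstance] at h
    have : (1 + ∫ U, u U ∂μ) / 2 - (1 + ∫ U, u U ∂μ') / 2 = ((∫ U, u U ∂μ) - ∫ U, u U ∂μ') / 2 := by
      ring
    rw [this, abs_div, abs_two] at h
    linarith
  -- the real and imaginary parts of `g`
  have hRe := key (fun U => (g U).re) (fun x y hxy => by show (g x).re = (g y).re; rw [hgcyl hxy])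
    (Complex.measurable_re.comp hgm) (fun U => (Complex.abs_re_le_norm _).trans (hgb U))
  have hIm := key (fun U => (g U).im) (fun x y hxy => by show (g x).im = (g y).im; rw [hgcyl hxy])
    (Complex.measurable_im.comp hgm) (fun U => (Complex.abs_im_le_norm _).trans (hgb U))
  have hgi : ∀ ν : Measure (LGConfig 4 G), IsProbabilityMeasure ν → Integrable g ν := fun ν _ =>
    (integrable_const (1 : ℝ)).mono' hgm.aestronglyMeasurable (ae_of_all _ fun U => hgb U)
  have hre : ∀ ν : Measure (LGConfig 4 G), IsProbabilityMeasure ν →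
      ∫ U, (g U).re ∂ν = (∫ U, g U ∂ν).re := fun ν hν => by
    simpa using Complex.reCLM.integral_comp_comm (hgi ν hν)
  have him : ∀ ν : Measure (LGConfig 4 G), IsProbabilityMeasure ν →
      ∫ U, (g U).im ∂ν = (∫ U, g U ∂ν).im := fun ν hν => by
    simpa using Complex.imCLM.integral_comp_comm (hgi ν hν)
  rw [hre μ inferInstance, hre μ' inferInstance] at hRe
  rw [him μ inferInstance, him μ' inferInstance] at hIm
  -- the charged identity `∫ g dμ' = c ∫ g dμ`
  have hch : ∫ U, g U ∂μ' = c * ∫ U, g U ∂μ :=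
    integral_charged_layerTwist ρ hρ hg β k (rowRegion b n) ζ hgm hcharged
  set I := ∫ U, g U ∂μ with hIdef
  have hdiff : I - ∫ U, g U ∂μ' = (1 - c) * I := by rw [hch]; ring
  have hnorm : ‖(1 - c) * I‖ ≤ 4 * ε := by
    rw [← hdiff]
    refine (Complex.norm_le_abs_re_add_abs_im _).trans ?_
    rw [Complex.sub_re, Complex.sub_im]
    linarith
  have hc' : 0 < ‖1 - c‖ := norm_pos_iff.2 (sub_ne_zero.2 (Ne.symm hc))
  rw [le_div_iff₀ hc', mul_comm]
  simpa [norm_mul] using hnorm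

/-- **PROVED (S). Real, sharp form for ANTI-charged tests** (`u ∘ τ_k = −u`, e.g. a `ℤ₂` or centre-sign column):
clause (i_T) at the row with the single test `f = (1 + u)/2` gives `|∫ u dγ_row(ζ)| ≤ ε` — no constant lost. -/
theorem abs_integral_anticharged_le_of_clauseI (hρ : Continuous ρ) {β : ℝ} {b n : ℕ} {ε : ℝ}
    {Typ : (Fin 4 → ℤ) → Set (LGConfig 4 G)} (hI : ClauseI ρ β (stdFrame b) n ε Typ)
    {g₀ : G} (hg : g₀ ∈ Subgroup.center G) {k : ℤ} (hk : 1 ≤ k ∧ k ≤ (b : ℤ))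
    {u : LGConfig 4 G → ℝ} (hum : Measurable u) (hub : ∀ U, |u U| ≤ 1)
    (hucyl : IsCylinder u (cellEdges (stdFrame b) 0)) (hanti : ∀ U, u (layerTwist k g₀ U) = -u U)
    (ζ : LGConfig 4 G)
    (hζ : ∀ c' ∈ windowCellsPlus n, c' ∉ rowCells n → ζ ∈ Typ c' ∧ layerTwist k g₀ ζ ∈ Typ c') :
    |∫ U, u U ∂(ymSpecification ρ β (rowRegion b n) ζ)| ≤ ε := by
  classical
  set μ := ymSpecification ρ β (rowRegion b n) ζ with hμ
  set μ' := ymSpecification ρ β (rowRegion b n) (layerTwist k g₀ ζ) with hμ'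
  haveI : IsProbabilityMeasure μ := isProbabilityMeasure_ymSpecification ρ hρ β _ ζ
  haveI : IsProbabilityMeasure μ' := isProbabilityMeasure_ymSpecification ρ hρ β _ _
  have hcyl : IsCylinder (fun U => (1 + u U) / 2) (cellEdges (stdFrame b) 0) := by
    intro x y hxy
    show (1 + u x) / 2 = (1 + u y) / 2
    rw [hucyl hxy]
  have h01 : ∀ U, 0 ≤ (1 + u U) / 2 ∧ (1 + u U) / 2 ≤ 1 := fun U => by
    have := abs_le.1 (hub U)
    constructor <;> linarith [this.1, this.2]
  have h : |(∫ U, (1 + u U) / 2 ∂μ) - ∫ U, (1 + u U) / 2 ∂μ'| ≤ ε :=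
    hI (rowCells n) (rowCells_subset n) (zero_mem_rowCells n) ζ (layerTwist k g₀ ζ) hζ
      (layerTwist_agree_off_row hk g₀ ζ) _ hcyl ((measurable_const.add hum).div_const 2) h01
  have hi : ∀ ν : Measure (LGConfig 4 G), IsProbabilityMeasure ν → Integrable u ν := fun ν _ =>
    (integrable_const (1 : ℝ)).mono' hum.aestronglyMeasurable
      (ae_of_all _ fun U => by simpa [Real.norm_eq_abs] using hub U)
  have hshift : ∀ ν : Measure (LGConfig 4 G), IsProbabilityMeasure ν →
      ∫ U, (1 + u U) / 2 ∂ν = (1 + ∫ U, u U ∂ν) / 2 := by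
    intro ν hν
    have h1 : ∫ U, (1 + u U) ∂ν = 1 + ∫ U, u U ∂ν := by
      rw [integral_add (integrable_const _) (hi ν hν)]
      simp
    simp_rw [div_eq_mul_inv]
    rw [integral_mul_const, h1]
  -- the anti-charged identity `∫ u dμ' = -∫ u dμ`
  have hflip : ∫ U, u U ∂μ' = -∫ U, u U ∂μ := by
    rw [hμ', ← ymSpecification_map_layerTwist ρ hρ hg β k (rowRegion b n) ζ,
      integral_map (measurable_layerTwist k g₀).aemeasurable hum.aestronglyMeasurable]
    simp_rw [hanti]
    exact integral_neg _
  rw [hshift μ inferInstance, hshift μ' inferInstance, hflip] at h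
  have : (1 + ∫ U, u U ∂μ) / 2 - (1 + -∫ U, u U ∂μ) / 2 = ∫ U, u U ∂μ := by ring
  rwa [this] at h

end ColumnBound

end Summit.QuantumFields.YangMills.Cruxes.IR.FixedMesh

end
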